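import Literature.NumberTheory.NumberFields.RayClassFieldTwoVariableTowerDataOffset
import HarnessLib

/-!
# THE LOCAL TOWER DATA OF THE (c)-CAPSTONE WITH THE FROBENIUS-ORDER HYPOTHESIS AT LEVEL `n₀`:
# `f ∣ ord Frob_v(K(𝔤₀v'^{n₀}))` (instead of `f ∣ ord Frob_v(K(𝔤₀))`) suffices for `hinert₀` — the frame generator `α` may be taken `≡ 1 mod 𝔤₀v'^{n₀}`

`RayClassFieldFrobeniusOrderFull` / `RayClassFieldTwoVariableTowerDataOffset` (g17 S49/S50) discharge the INERT binder `hinert₀` of the (c)-capstone tower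
from ONE `α ≡ 1 mod 𝔤₀`, `(α) = 𝔭_v^f`, under `hfo : f ∣ ord Frob_v(K(𝔤₀)/K)` — which forces `f = o(𝔤₀)` and `α = ±π₀^{o(𝔤₀)/h}` (`𝔭_v^h = (π₀)`), and
then the Coleman-frame binder `hαπ : α = π^f in K_v` FAILS whenever `o(𝔤₀)` is even and `π₀^{o(𝔤₀)/h} ≡ −1 mod 𝔤₀` (`−1` is not a square in `ℚ₂`;
memo BRICK-C-TRACE-g17 F11).  The growth lemma uses `hfo` ONLY through `K(𝔤₀) ≤ K(𝔤₀v'^n)`; so it holds verbatim with the divisibility asked at ANY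
level `n₀ ≤ n`.  THIS file (theorems only; no `sorry`; no definitions) proves the level-`n₀` forms

* ★ `mul_pow_prime_succ_dvd_orderOf_galFrob_of_dvd_orderOf_level` — `f ∣ ord Frob_v(K(𝔤v'^{n₀}))`, `n₀ ≤ n`, `m ≤ n` ⟹
  `f·p^{n−m+1} ∣ ord Frob_v(K(𝔤v'^n))`; `…_frob_idelic_…_level` (idelic form);
* ★★ **`towerDataOffset_hinert_of_level`** — `hinert₀` for ANY offset `c` with `[E_{i+c} : K_v] = f·p^{i+1}` (`c = r + 1` for `f = d₀p^r`,
  `[E_j] = d₀p^j`: `finrank_add_offset_eq`), for `𝔤 = 𝔤₀v'^a` under **`hfo' : f ∣ ord Frob_v(K(𝔤₀v'^a))`** (level `n₀ = a`, the base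
  conductor of the two-variable tower itself); `dvd_orderOf_galFrob_mul_pow_of_dvd_orderOf` (`f ∣ o(𝔤₀) ⟹ f ∣ o(𝔤₀v'^a)`);

so that the frame generator can be chosen `α ≡ 1 mod 𝔤₀v'²` (`RayClassFieldTwoVariableFrameGenerator`: then `α = π^f` for a LOCAL uniformiser `π`
always, class number odd).  `hdegE` / `hcount` of S50 do not involve `α` and are reused as they are.  Cell `bsd-print-cf2`, width seat
`bsd-line-cf2c-w7` g19.

## References
* [deShalit1987] E. de Shalit, *Iwasawa theory of elliptic curves with complex multiplication* (1987), II.1.9 (p. 43), II.1.10 (p. 39),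
  II.4.14 (p. 71), II.4.17 (p. 78).
* [NeukirchANT1999] J. Neukirch, *Algebraic Number Theory* (1999), Ch. VI §7 Thm. (7.1), Cor. (7.3); Ch. IV §4.
* [Serre1973CourseArithmetic] J.-P. Serre, *A Course in Arithmetic* (1973), Ch. II §3.1.
-/

noncomputable section

open NumberField IsDedekindDomain IsDedekindDomain.HeightOneSpectrum Field WithZero
open scoped nonZeroDivisors Classical

namespace Literature.NumberTheory.NumberFields

open Literature.NumberTheory.GaloisRepresentations
open Literature.NumberTheory.GaloisRepresentations.IsNonarchimedeanLocalField
open Literature.NumberTheory.GaloisRepresentations.ArtinLocalGlobal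
open Literature.RingTheory.DedekindDomain
open ValuativeRel

variable {K : Type} [Field K] [NumberField K] {𝔤₀ : Ideal (𝓞 K)} {v v' : HeightOneSpectrum (𝓞 K)}

/-! ### §0. Moduli bookkeeping -/

omit [NumberField K] in
/-- `𝔤₀v'^a·v'^{i+1} = 𝔤₀·v'^{a+(i+1)}`. [folklore] -/
private theorem moduli_eq₂₃ (a i : ℕ) : 𝔤₀ * v'.asIdeal ^ a * v'.asIdeal ^ (i + 1) = 𝔤₀ * v'.asIdeal ^ (a + (i + 1)) := by
  rw [mul_assoc, ← pow_add]

/-- `v ∤ 𝔤₀v'^n` for `v ∤ 𝔤₀`, `v ≠ v'`. [cite: deShalit1987, II.4.14 (p. 71)] -/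
private theorem not_mul_pow_le₂₃ (hv : ¬ 𝔤₀ ≤ v.asIdeal) (hvv' : v' ≠ v) (n : ℕ) : ¬ 𝔤₀ * v'.asIdeal ^ n ≤ v.asIdeal := by
  intro h
  rcases (v.isPrime.mul_le).mp h with h1 | h2
  · exact hv h1
  · rcases n with _ | n
    · rw [pow_zero, Ideal.one_eq_top, top_le_iff] at h2
      exact v.isPrime.ne_top h2
    · exact hvv' (HeightOneSpectrum.ext ((v'.isMaximal.eq_of_le v.isPrime.ne_top ((Ideal.IsPrime.pow_le_iff (hP := v.isPrime)
        (Nat.succ_ne_zero n)).mp h2))))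

variable [IsTotallyComplex K]
  (h𝔤0 : 𝔤₀ ≠ ⊥) (hv : ¬ 𝔤₀ ≤ v.asIdeal) (hv' : ¬ 𝔤₀ ≤ v'.asIdeal) (hvv' : v' ≠ v)
  (hw𝔤 : ∀ u : (𝓞 K)ˣ, (u : 𝓞 K) - 1 ∈ 𝔤₀ → u = 1)
  {p : ℕ} (hp : p.Prime) (hpv' : (p : 𝓞 K) ∈ v'.asIdeal) (hpv'2 : (p : 𝓞 K) ∉ v'.asIdeal ^ 2)

/-! ### §1. The growth lemma with the divisibility asked at level `n₀` -/

section Growth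

variable {α : 𝓞 K} (hα0 : α ≠ 0) (hα𝔤 : α - 1 ∈ 𝔤₀) {f : ℕ} (hαf : Ideal.span {α} = v.asIdeal ^ f)

include h𝔤0 hv hv' hvv' hw𝔤 hp hpv' hpv'2 hα0 hα𝔤 hαf in
/-- ★ **`f·p^{n−m+1} ∣ ord Frob_v(K(𝔤v'^n)/K)`** for `n ≥ m`, `n ≥ n₀`, whenever `(α) = 𝔭_v^f` with `α ≡ 1 mod 𝔤` of `v'`-level `ℓ ≥ 1`, `α^p` of exact
level `m`, and **`f ∣ ord Frob_v(K(𝔤v'^{n₀})/K)`** (level `n₀`; `n₀ = 0` is `RayClassFieldFrobeniusOrderFull.mul_pow_prime_succ_dvd_orderOf_galFrob_of_dvd_orderOf`):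
the order `t` on `K(𝔤v'^n) ⊇ K(𝔤v'^{n₀})` is a multiple of `f`, `t = f·j`, and `Frob^{f·j} = ((α^j), ·) = 1` gives `p^{n−m+1} ∣ j`.
[cite: deShalit1987, II.1.9 (p. 43), II.4.14 (p. 71)] [cite: NeukirchANT1999, Ch. VI §7 Cor. (7.3)] [cite: Serre1973CourseArithmetic, Ch. II §3.1] -/
theorem mul_pow_prime_succ_dvd_orderOf_galFrob_of_dvd_orderOf_level {ℓ m : ℕ} (hℓ : 1 ≤ ℓ) (hαℓ : v'.intValuation (α - 1) = exp (-(ℓ : ℤ)))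
    (hm2 : 2 ≤ m ∨ p ≠ 2) (hαm : v'.intValuation (α ^ p - 1) = exp (-(m : ℤ))) {n₀ : ℕ}
    (hfo : f ∣ orderOf (galFrob K (rayClassField K (𝔤₀ * v'.asIdeal ^ n₀)) v)) {n : ℕ} (hn₀ : n₀ ≤ n) (hn : m ≤ n) :
    f * p ^ (n - m + 1) ∣ orderOf (galFrob K (rayClassField K (𝔤₀ * v'.asIdeal ^ n)) v) := by
  have hft : f ∣ orderOf (galFrob K (rayClassField K (𝔤₀ * v'.asIdeal ^ n)) v) :=
    hfo.trans (orderOf_galFrob_dvd_of_le (mul_ne_zero h𝔤0 (pow_ne_zero _ v'.ne_bot)) (mul_ne_zero h𝔤0 (pow_ne_zero _ v'.ne_bot))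
      (not_mul_pow_le₂₃ hv hvv' n₀) (not_mul_pow_le₂₃ hv hvv' n)
      (rayClassField_le_of_le (mul_ne_zero h𝔤0 (pow_ne_zero _ v'.ne_bot)) (Ideal.mul_mono_right (Ideal.pow_le_pow_right hn₀))))
  obtain ⟨j, hj⟩ := hft
  have h1 : artinHom (galFrob K (rayClassField K (𝔤₀ * v'.asIdeal ^ n)))
      (toPrincipalIdeal (𝓞 K) K (Units.mk0 ((α ^ j : 𝓞 K) : K) (by exact_mod_cast pow_ne_zero j hα0))) = 1 := by
    rw [← galFrob_pow_mul_eq_artinHom_pow hα0 hαf, ← hj]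
    exact pow_orderOf_eq_one _
  rw [hj]
  exact mul_dvd_mul_left f (pow_prime_succ_dvd_of_artinHom_pow_eq_one h𝔤0 hv' hw𝔤 hp hpv' hpv'2 hα0 hα𝔤 hℓ hαℓ hm2 hαm hn h1)

include h𝔤0 hv hv' hvv' hw𝔤 hp hpv' hpv'2 hα0 hα𝔤 hαf in
/-- ★ **Idelic form at level `n₀`**: for a uniformiser `π` of `K_v`, `f·p^{n−m+1} ∣ ord [⟨π⟩_v, K]|_{K(𝔤v'^n)}` (`n ≥ m`, `n ≥ n₀`,
`f ∣ ord Frob_v(K(𝔤v'^{n₀}))`). [cite: deShalit1987, II.1.10 (p. 39), II.4.14 (p. 71)] [cite: NeukirchANT1999, Ch. VI §7 Thm. (7.1)] -/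
theorem mul_pow_prime_succ_dvd_orderOf_frob_idelic_of_dvd_orderOf_level {ℓ m : ℕ} (hℓ : 1 ≤ ℓ)
    (hαℓ : v'.intValuation (α - 1) = exp (-(ℓ : ℤ))) (hm2 : 2 ≤ m ∨ p ≠ 2) (hαm : v'.intValuation (α ^ p - 1) = exp (-(m : ℤ))) {n₀ : ℕ}
    (hfo : f ∣ orderOf (galFrob K (rayClassField K (𝔤₀ * v'.asIdeal ^ n₀)) v)) {n : ℕ} (hn₀ : n₀ ≤ n) (hn : m ≤ n)
    {π : 𝒪[v.adicCompletion K]} (hπ : (valuation (v.adicCompletion K)).IsUniformizer (π : v.adicCompletion K)) :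
    ((f * p ^ (n - m + 1) : ℕ) : ℤ) ∣ (orderOf (abRestrict (rayClassField K (𝔤₀ * v'.asIdeal ^ n))
      (ideleArtinMap K (localUnits v (Units.mk0 (π : v.adicCompletion K) hπ.ne_zero)))) : ℤ) := by
  rw [abRestrict_ideleArtinMap_rayClassField_localUnits (mul_ne_zero h𝔤0 (pow_ne_zero _ v'.ne_bot)) (not_mul_pow_le₂₃ hv hvv' n)
    (valued_eq_exp_neg_one_of_isUniformizer (hx := hπ))]
  exact_mod_cast mul_pow_prime_succ_dvd_orderOf_galFrob_of_dvd_orderOf_level h𝔤0 hv hv' hvv' hw𝔤 hp hpv' hpv'2 hα0 hα𝔤 hαf hℓ hαℓ hm2 hαm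
    hfo hn₀ hn

end Growth

/-! ### §2. `hinert₀` for ANY offset `c` with `[E_{i+c} : K_v] = f·p^{i+1}`, under the level-`a` hypothesis `f ∣ ord Frob_v(K(𝔤₀v'^a))` -/

section Inert

-- binder order follows `RayClassFieldTwoVariableTowerDataOffset.towerDataOffset_hinert` up to `hαa`; then `hfo' E hE c hdegc`
variable {π : 𝒪[v.adicCompletion K]} (hπ : (valuation (v.adicCompletion K)).IsUniformizer (π : v.adicCompletion K))
  {α : 𝓞 K} (hα0 : α ≠ 0) (hα𝔤 : α - 1 ∈ 𝔤₀) {f : ℕ} (hαf : Ideal.span {α} = v.asIdeal ^ f)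
  {ℓ a : ℕ} (hℓ : 1 ≤ ℓ) (hαℓ : v'.intValuation (α - 1) = exp (-(ℓ : ℤ)))
  (ha2 : 2 ≤ a + 1 ∨ p ≠ 2) (hαa : v'.intValuation (α ^ p - 1) = exp (-((a + 1 : ℕ) : ℤ)))
  (hfo' : f ∣ orderOf (galFrob K (rayClassField K (𝔤₀ * v'.asIdeal ^ a)) v))
  (E : ℕ → IntermediateField (v.adicCompletion K) (AlgebraicClosure (v.adicCompletion K)))
  [∀ j, FiniteDimensional (v.adicCompletion K) (E j)]
  (hE : ∀ j, E j ≤ maxUnramified (v.adicCompletion K))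
  -- an OFFSET `c` with `[E_{i+c} : K_v] = f·p^{i+1}`
  (c : ℕ) (hdegc : ∀ i : ℕ, Module.finrank (v.adicCompletion K) (E (i + c)) = f * p ^ (i + 1))

include h𝔤0 hv hv' hvv' hw𝔤 hp hpv' hpv'2 hπ hα0 hα𝔤 hαf hℓ hαℓ ha2 hαa hfo' hE hdegc in
/-- ★★ **`hinert₀` for any offset `c` under the LEVEL-`a` hypothesis** (INERT from level `0`): every `τ ∈ Γ_{K_v}` fixing `ι K(𝔤v'^{i+1})`
pointwise (`𝔤 = 𝔤₀v'^a`) fixes `E_{i+c}`, because `[E_{i+c}:K_v] = f·p^{i+1}` divides `ord Frob_v(K(𝔤₀v'^{a+i+1}))` — growth from `α` with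
`f ∣ ord Frob_v(K(𝔤₀v'^a))` only (so `α ≡ 1 mod 𝔤₀v'^a`, `f = o(𝔤₀v'^a)` is admissible).  With `c = r + 1`, `f = d₀p^r`, `[E_j] = d₀p^j`
(`finrank_add_offset_eq`) this is the conclusion of `towerDataOffset_hinert`, letter for letter, under the weaker hypothesis.
[cite: deShalit1987, II.1.10 (p. 39), II.4.14 (p. 71)] [cite: NeukirchANT1999, Ch. VI §7 Cor. (7.3)] -/
theorem towerDataOffset_hinert_of_level : ∀ i : ℕ, ∀ τ : absoluteGaloisGroup (v.adicCompletion K),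
    (∀ y ∈ rayClassField K (𝔤₀ * v'.asIdeal ^ a * v'.asIdeal ^ (i + 1)),
      τ • absClosureEmbedding K (v.adicCompletion K) y = absClosureEmbedding K (v.adicCompletion K) y) →
      τ ∈ (E (i + c)).fixingSubgroup := by
  intro i τ hτ
  rw [moduli_eq₂₃] at hτ
  refine mem_fixingSubgroup_of_forall_smul_absClosureEmbedding_eq_of_finrank_dvd_orderOf (mul_ne_zero h𝔤0 (pow_ne_zero _ v'.ne_bot))
    (not_mul_pow_le₂₃ hv hvv' _) hπ (E (i + c)) (hE (i + c)) ?_ hτ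
  have h := mul_pow_prime_succ_dvd_orderOf_frob_idelic_of_dvd_orderOf_level h𝔤0 hv hv' hvv' hw𝔤 hp hpv' hpv'2 hα0 hα𝔤 hαf hℓ hαℓ ha2 hαa hfo'
    (n := a + (i + 1)) (by omega) (by omega) hπ
  rw [show a + (i + 1) - (a + 1) + 1 = i + 1 by omega] at h
  rwa [hdegc i]

omit [IsTotallyComplex K] [∀ j, FiniteDimensional (v.adicCompletion K) (E j)] in
/-- The offset of the (c)-capstone: `f = d₀p^r`, `[E_j : K_v] = d₀p^j ⟹ [E_{i+r+1} : K_v] = f·p^{i+1}`. [cite: deShalit1987, II.1.10 (p. 39)] -/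
theorem finrank_add_offset_eq {d₀ r : ℕ} (hf : f = d₀ * p ^ r) (hEdeg : ∀ j, Module.finrank (v.adicCompletion K) (E j) = d₀ * p ^ j) :
    ∀ i : ℕ, Module.finrank (v.adicCompletion K) (E (i + (r + 1))) = f * p ^ (i + 1) := fun i ↦ by
  rw [hEdeg, hf]; ring

omit [IsTotallyComplex K] in
include h𝔤0 hv hvv' in
/-- The level-`0` hypothesis implies the level-`a` one: `f ∣ o(𝔤₀) ⟹ f ∣ o(𝔤₀v'^a)` (`K(𝔤₀) ≤ K(𝔤₀v'^a)`), so every instance of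
`towerDataOffset_hinert` is an instance of `towerDataOffset_hinert_of_level`. [cite: NeukirchANT1999, Ch. VI §7 Cor. (7.3)] -/
theorem dvd_orderOf_galFrob_mul_pow_of_dvd_orderOf (hfo : f ∣ orderOf (galFrob K (rayClassField K 𝔤₀) v)) (a : ℕ) :
    f ∣ orderOf (galFrob K (rayClassField K (𝔤₀ * v'.asIdeal ^ a)) v) :=
  hfo.trans (orderOf_galFrob_dvd_of_le h𝔤0 (mul_ne_zero h𝔤0 (pow_ne_zero _ v'.ne_bot)) hv (not_mul_pow_le₂₃ hv hvv' a)
    (rayClassField_le_of_le (mul_ne_zero h𝔤0 (pow_ne_zero _ v'.ne_bot)) Ideal.mul_le_right))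

end Inert

end Literature.NumberTheory.NumberFields

end
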